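import Summits.ABC.IUTFork.Conditional.AbcOfSGenuineMShrinkDepthStar
import Summits.ABC.IUTFork.Conditional.AbcOfSGenuineMLinUniform
import Summits.ABC.IUTFork.Conditional.AbcOfSGenuineKChosenDepthRadRatPoint
import Summits.ABC.IUTFork.Cor312PilotIdelesMReadOrders
import Literature.IUT.LogVolume.DHUnitLogCrudeBound
import HarnessLib

/-!
# Branch C, M line / R-W lane P−: the EXACT-RADIUS («RAD») refutation at RATIONAL points ON THE M LINE — the M-twin socket of
# abc-iut-w5-d236's `AbcOfSGenuineKChosenDepthRadRatPoint` (the «M port of the RAD certificate» of the R-W numerics lead's M-TWIN-GAP)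

PROOF-ONLY file (no `def`, no new `Prop`, no instance) of the abc-iut cell (D-0079 R-W numerics crew seat abc-iut-W-num-6, gen 2; row
«W:M-RAD-PORT»). TAKES NO SIDE on [IUTchIII] Cor. 3.12 or on any author. NO new engine: abc-iut-w6-d114's M-line [STAR]×[RAD] per-datum theorem
`GenuineMShrink2.not_pilotKummerCompatHull_of_explicitDepth_star_radius` (p462361; any radius `r` bounding `‖log_p‖` on `𝒪^×_{x₀}`) is fed with
abc-iut-c312-3's ENVELOPE radius `‖ϖ‖^{p^{a₀} − e·a₀}` (`LogEnvelope.forall_mem_logUnits_norm_le_envelope`) and abc-iut-w6-d114's diagonal constants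
(`dSum_aSum_bSum_kk_const`), exactly as this seat's K-line `Thm311.Real.not_exists_qPinned_hull_settingPrVolSharp_of_realising_star_envelope` (p463492):
* §1 `GenuineMShrink2.not_pilotKummerCompatHull_of_star_envelope_ineq` — at the summand-route M-level sharp setting of the volume input of `D`
  (Θ-ideles `tOfIdeleData D (ideleDataOf D hI)`, q-ideles `tqM`, PINNED reading — the data of `abc_of_SH_v10M` / `…_v11M_window`), a place `u`,
  label `i+1`, member `x₀ ∈ V̲_u` with `‖t_{q,x₀}‖ = p^{−P/e}` (`P ∈ ℕ`), a turning point `a₀` of `e = e(K_{v̲(x₀)}/ℚ_p)` and the ONE real inequality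
  **`P/e < ⌊(i+1)²P/e − (i+1)·d − (i+2)·a⌋ + (i+2)·(p^{a₀} − e·a₀)/e`** (`d`, `a` of `K_{v̲(x₀)}`; the K-line shape of p463434) ⇒ ¬ PilotKummerCompatHull;
* §2 `GenuineM.not_pilotKummerCompatHull_ratPoint_of_star_envelope_of_not_dvd` — the M TWIN of abc-iut-w5-d236's
  `GenuineK.not_pilotKummerCompatHull_chosen_ratPoint_of_star_envelope_of_not_dvd` (p464754): `λ ∈ ℚ`, `T` a genuine Θ-volume datum at
  `(ratPoint λ, l)`, `u` a finite place of `ℚ` with `p = p_u ≠ 2, l` at which `j(λ)` has a pole of order EXACTLY `h`, a label `i₀+1 ≤ l⋆`, a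
  classically tame local type `e` (`p ∤ e`) with its window `(A−1)(p−2) < e ≤ A(p−2)`, turning point `a₀`, and an integer `N` with the two RAD
  inequalities `2l·e·N ≤ (i₀+1)²·h·e − 2l·((i₀+1)(e−1) + (i₀+2)·A)`, `h·e < 2l·(e·N + (i₀+2)(p^{a₀} − e·a₀))` ⇒ at EVERY member `x₀ ∈ V̲_u` of local
  type `e` the hull-level clause S_H FAILS at the summand-route M-level sharp setting of `T`'s OWN read-off ideles, pinned reading, for every choice
  of the free context binders and Kummer datum. Inputs BY NAME: abc-iut-w5-d166's `placeModOfM_mem_S_and_norm_tqM_le_of_ratPoint` (the member is bad),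
  `norm_tqM_eq_rpow_ord_rat` (`‖t_{q,x₀}‖ = p^{ord_p j(λ)/(2l)} = p^{−h/(2l)}` EXACTLY), `exists_int_norm_tqM_eq_zpow` (integer order), the closed forms
  `differentOrd_eq_of_not_dvd` / `logRadiusA_eq_of_window`, and abc-iut-w5-d236's arithmetic `RadRow.real_test_of_certificate` / `turning_of_bounds`.
The certificate-list triple form and the rows (the RAD part of HOME/plan/rescue/R-W/M-TWIN-GAP.tsv) are filed separately.
HONEST SCOPE (binding, as the parents): SHARP reading (Θ-possible-image set constant in `m`, typed (Ind1)/(Ind2) = Dupuy–Hilado families); per-label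
licence STRONGER than print; nothing about the printed GLOBAL inequality, the number-level Corollary (`Cor22.Cor312AtDatum`) or any author's intended hull;
admissibility / Szpiro-badness / (P6) / non-emptiness of the datum type NOT claimed; «refuted as typed» ≠ «refuted in print»; typed ≠ proved;
instantiated ≠ endorsed; nothing here asserts that abc is proved or refuted. [cite: Mochizuki2012, IUTchIII Cor. 3.12 Step (xi-f) p. 184; IUTchIV Prop. 1.1 p. 9,
Prop. 1.2 (i)(ii) p. 10, Cor. 2.2 (ii) proof (P5) p. 46] [cite: DupuyHilado2025, §3.3, §3.4, §4.12] [cite: NeukirchANT1999, Ch. II (5.5)]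
[cite: SerreLocalFields1979, Ch. III §6 Prop. 13] [claim: Mochizuki2012, status: disputed] for every IUT sentence quoted.
-/

noncomputable section

open Set Function NumberField IsDedekindDomain

namespace Summit.ABC.IUTFork.Conditional

open Thm311 Thm311.Real Cor312 Cor312Vol Cor312Prov Literature.IUT.LogThetaLattice Literature.IUT.LogVolume
  Literature.IUT.HodgeTheaters Literature.IUT.LogVolume.ThetaData Literature.IUT.LogVolume.Cor22
  Literature.IUT.LogVolume.LogEnvelope Literature.NumberTheory.NumberFields
open Literature.NumberTheory.GaloisRepresentations.Ultrametric
open Literature.NumberTheory.DiophantineGeometry.GenEll Summit.ABC.ABC.Theorems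

/-! ## §1. The M-line [STAR] × ENVELOPE socket, one real inequality -/

section PerDatum

variable {F K Fbar : Type} [Field F] [NumberField F] [Field K] [NumberField K] [Algebra F K] [Field Fbar]
  [Algebra F Fbar] [Algebra K Fbar] {E : WeierstrassCurve F} [E.IsElliptic] {l : ℕ} {Pb : BadPlacePredicates K}

variable (D : InitialThetaData F K Fbar E l Pb) {I : ThetaVolumeInput (fieldOfModuli E) K}
  (M : Type) [Field M] [NumberField M]
  (archPk : ∀ (j : (thetaIndexOfInitial D).Label) (vQ : (thetaIndexOfInitial D).VQ),
    Set ((logShellsOfInitialDH D (analyticLogvVal K)).Packet j vQ))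
  (archSub : ∀ (j : (thetaIndexOfInitial D).Label) (v : (thetaIndexOfInitial D).V),
    Set ((logShellsOfInitialDH D (analyticLogvVal K)).Packet j ((thetaIndexOfInitial D).over v)))
  (Ψ : ℤ → ∀ v : (thetaIndexOfInitial D).V, v ∈ (thetaIndexOfInitial D).Vbad →
    Set ((logShellsOfInitialDH D (analyticLogvVal K)).StarPacket v))
  (act : ℤ → ∀ v : (thetaIndexOfInitial D).V, v ∈ (thetaIndexOfInitial D).Vbad →
    (logShellsOfInitialDH D (analyticLogvVal K)).StarPacket v →
      Module.End ℚ ((logShellsOfInitialDH D (analyticLogvVal K)).StarPacket v))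
  (Mmod : ℤ → ∀ j : (thetaIndexOfInitial D).LabelStar, Set ((logShellsOfInitialDH D (analyticLogvVal K)).GlobalPacket j.1))
  (region : ℤ → ∀ j : (thetaIndexOfInitial D).LabelStar, FinDivisor M → ∀ vQ : (thetaIndexOfInitial D).VQ,
    Set ((logShellsOfInitialDH D (analyticLogvVal K)).Packet j.1 vQ))
  (frobAdm : ℤ → ℤ → ∀ (j : (thetaIndexOfInitial D).Label) (vQ : (thetaIndexOfInitial D).VQ),
    Set ((logShellsOfInitialDH D (analyticLogvVal K)).Packet j vQ) → Prop)
  (frobLogvol : ℤ → ℤ → ∀ (j : (thetaIndexOfInitial D).Label) (vQ : (thetaIndexOfInitial D).VQ),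
    Set ((logShellsOfInitialDH D (analyticLogvVal K)).Packet j vQ) → ℝ)
  (frobΨ : ℤ → ℤ → ∀ v : (thetaIndexOfInitial D).V, v ∈ (thetaIndexOfInitial D).Vbad →
    Set ((logShellsOfInitialDH D (analyticLogvVal K)).StarPacket v))
  (frobMmod : ℤ → ℤ → ∀ j : (thetaIndexOfInitial D).LabelStar, Set ((logShellsOfInitialDH D (analyticLogvVal K)).GlobalPacket j.1))
  (unitImage : ℤ → ℤ → ℕ → ∀ (j : (thetaIndexOfInitial D).Label) (vQ : (thetaIndexOfInitial D).VQ),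
    Set ((logShellsOfInitialDH D (analyticLogvVal K)).Packet j vQ))
  (ballImage : ℤ → ℤ → ∀ (j : (thetaIndexOfInitial D).Label) (vQ : (thetaIndexOfInitial D).VQ),
    Set ((logShellsOfInitialDH D (analyticLogvVal K)).Packet j vQ))
  (thetaDiv : ℤ → ℤ → LgpDivisor M (thetaIndexOfInitial D).lstar)
  (n : ℤ) {HT : Type} {LogLink : HT → HT → Type} {IsFull : ∀ {s t : HT}, LogLink s t → Prop}
  (lat : LGPGaussianLogThetaLattice LogLink IsFull)
  {Frd : Type} {IsoF : Frd → Frd → Type} {Ob : Frd → Type} {realify : Frd → Frd} {Strip : Type}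
  {IsoS : Strip → Strip → Type} {Mv : ∀ v : (thetaIndexOfInitial D).V, v ∈ (thetaIndexOfInitial D).Vbad → Type}
  [∀ v h, Monoid (Mv v h)]
  (sig : GlobalLGPFrobenioidSignature (thetaIndexOfInitial D).lstar (thetaIndexOfInitial D).V
    (· ∈ (thetaIndexOfInitial D).Vbad) Frd IsoF Ob realify Strip IsoS Mv)
  (split : SplittingMonoids Mv) {ObΔ : Type} {N : ∀ v : (thetaIndexOfInitial D).V, v ∈ (thetaIndexOfInitial D).Vbad → Type}
  [∀ v h, Monoid (N v h)] (qData : QPilotData ObΔ N)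
  (qK : ∀ v : (thetaIndexOfInitial D).V, v ∈ (thetaIndexOfInitial D).Vbad →
    Set ((logShellsOfInitialDH D (analyticLogvVal K)).StarPacket v))

/-- **[STAR]×ENVELOPE on the M line, ONE real inequality.** At the summand-route M-level sharp setting of the volume input `I` of `D`
(own Θ-ideles, read-off q-ideles `tqM`, pinned reading), for a finite place `u` of `ℚ` (prime `p = p_u`), a label `j = i+1`, a member
`x₀ ∈ V̲_u` with `K₀ = K_{v̲(x₀)}`, `e = e(K₀/ℚ_p)`, `‖t_{q,x₀}‖ = p^{−P/e}` (`P ∈ ℕ`), and a turning point `a₀` of `e`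
(`p^a(p−1) < e` for `a < a₀`, `e ≤ p^{a₀}(p−1)`): the real inequality `P/e < ⌊(i+1)²·P/e − (i+1)·d(K₀) − (i+2)·a(p,e)⌋ + (i+2)·(p^{a₀} − e·a₀)/e`
refutes `PilotKummerCompatHull … (fun _ => qRegion) qK` — abc-iut-w6-d114's `…_of_explicitDepth_star_radius` at the envelope radius
`‖ϖ‖^{p^{a₀} − e·a₀}` of abc-iut-c312-3 (`forall_mem_logUnits_norm_le_envelope`), the diagonal constants `d_I − d = (i+1)·d`, `a_I = (i+2)·a`
(`dSum_aSum_bSum_kk_const`). M-line twin of abc-iut-w5-d236's `GenuineK.not_pilotKummerCompatHull_chosen_of_star_envelope`. Sharp reading;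
refuted-as-typed only. [cite: Mochizuki2012, IUTchIV Prop. 1.1 p. 9, Prop. 1.2 (i)(ii) p. 10] [cite: NeukirchANT1999, Ch. II (5.5)]
[cite: DupuyHilado2025, §3.4, §4.12] [claim: Mochizuki2012, status: disputed] -/
theorem GenuineMShrink2.not_pilotKummerCompatHull_of_star_envelope_ineq (hI : ThetaData.IsVolumeInputOf D I)
    (u : FinitePlace ℚ) (i : Fin (thetaIndexOfInitial D).lstar) (x₀ : (thetaIndexOfInitial D).Fibre (Val.non u)) (P : ℕ)
    (hq : ‖tqM D (ratChar u) u (natCast_ratChar_mem u) (ideleDataOf D hI) x₀‖ =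
      ((ratChar u : ℕ) : ℝ) ^ (-((((P : ℤ) : ℝ)) / absRamificationIdx (ratChar u) (kOfM D (ratChar u) u (natCast_ratChar_mem u) x₀))))
    (a₀ : ℕ) (hlo : ∀ a < a₀, ((ratChar u : ℕ) : ℤ) ^ a * (((ratChar u : ℕ) : ℤ) - 1) < absRamificationIdx (ratChar u) (kOfM D (ratChar u) u (natCast_ratChar_mem u) x₀))
    (hhi : (absRamificationIdx (ratChar u) (kOfM D (ratChar u) u (natCast_ratChar_mem u) x₀) : ℤ) ≤ ((ratChar u : ℕ) : ℤ) ^ a₀ * (((ratChar u : ℕ) : ℤ) - 1))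
    (hineq : (((P : ℤ) : ℝ)) / (absRamificationIdx (ratChar u) (kOfM D (ratChar u) u (natCast_ratChar_mem u) x₀) : ℝ) <
      ⌊((((((i : ℕ) + 1) ^ 2 * P : ℕ) : ℤ) : ℝ)) / (absRamificationIdx (ratChar u) (kOfM D (ratChar u) u (natCast_ratChar_mem u) x₀) : ℝ)
          - (((i : ℕ) : ℝ) + 1) * differentOrd (ratChar u) (kOfM D (ratChar u) u (natCast_ratChar_mem u) x₀)
          - (((i : ℕ) : ℝ) + 2) * logRadiusA (ratChar u) (absRamificationIdx (ratChar u) (kOfM D (ratChar u) u (natCast_ratChar_mem u) x₀))⌋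
        + (((i : ℕ) : ℝ) + 2) * ((((((ratChar u : ℕ) : ℤ) ^ a₀ - (absRamificationIdx (ratChar u) (kOfM D (ratChar u) u (natCast_ratChar_mem u) x₀) : ℤ) * (a₀ : ℤ) : ℤ)) : ℝ) / (absRamificationIdx (ratChar u) (kOfM D (ratChar u) u (natCast_ratChar_mem u) x₀) : ℝ))) :
    ¬ Cor312Vol.PilotKummerCompatHull
      (LatticeSituation.ofShells (logShellsOfInitialDH D (analyticLogvVal K)) M archPk archSub
        (summandPiecesPrM D (logvAnalyticVal_analyticLogvVal (K := K))).Adm (summandPiecesPrM D (logvAnalyticVal_analyticLogvVal (K := K))).logvol Ψ act Mmod region frobAdm frobLogvol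
        frobΨ frobMmod unitImage ballImage thetaDiv)
      (settingPrVolSharpM D (logvAnalyticVal_analyticLogvVal (K := K)) (tOfIdeleData D (ideleDataOf D hI))
        (fun u x => tqM D (ratChar u) u (natCast_ratChar_mem u) (ideleDataOf D hI) x) M archPk archSub Ψ act Mmod region n lat sig split qData
        (fun u x => tqM_ne_zero D (ratChar u) u (natCast_ratChar_mem u) (ideleDataOf D hI) x)
        (GenuineM.finite_ratPlaces_under_S D).toFinset
        (fun u x hu => norm_tqM_eq_one_of_not_mem D (ratChar u) u (natCast_ratChar_mem u) (ideleDataOf D hI) x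
          fun hx => hu ((Set.Finite.mem_toFinset _).mpr ⟨x, hx⟩)))
      (fun _ => Cor312.Setting.qRegion
        (settingPrVolSharpM D (logvAnalyticVal_analyticLogvVal (K := K)) (tOfIdeleData D (ideleDataOf D hI))
        (fun u x => tqM D (ratChar u) u (natCast_ratChar_mem u) (ideleDataOf D hI) x) M archPk archSub Ψ act Mmod region n lat sig split qData
        (fun u x => tqM_ne_zero D (ratChar u) u (natCast_ratChar_mem u) (ideleDataOf D hI) x)
        (GenuineM.finite_ratPlaces_under_S D).toFinset
        (fun u x hu => norm_tqM_eq_one_of_not_mem D (ratChar u) u (natCast_ratChar_mem u) (ideleDataOf D hI) x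
          fun hx => hu ((Set.Finite.mem_toFinset _).mpr ⟨x, hx⟩)))) qK := by
  haveI hpfact : Fact (ratChar u).Prime := inferInstance
  have hp0 : (0 : ℝ) < ((ratChar u : ℕ) : ℝ) := by exact_mod_cast hpfact.out.pos
  have hp1 : (1 : ℝ) < ((ratChar u : ℕ) : ℝ) := by exact_mod_cast hpfact.out.one_lt
  have he0 : (0 : ℝ) < (absRamificationIdx (ratChar u) (kOfM D (ratChar u) u (natCast_ratChar_mem u) x₀) : ℝ) := by
    exact_mod_cast absRamificationIdx_pos (ratChar u) (kOfM D (ratChar u) u (natCast_ratChar_mem u) x₀)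
  -- the envelope radius at the norm-uniformizer of `K₀`
  have hϖ : IsUniformizer (unifChoice (kOfM D (ratChar u) u (natCast_ratChar_mem u) x₀)) := isUniformizer_unifChoice _
  have hr := forall_mem_logUnits_norm_le_envelope (ratChar u) hϖ hlo hhi
  -- the diagonal summand's constants are `(i+2)` copies of the per-field ones
  obtain ⟨hds, has, -⟩ := dSum_aSum_bSum_kk_const D (logvAnalyticVal_analyticLogvVal (K := K)) u i x₀
  -- the engine's floor exponent is the one of `hineq`
  have hfloor : ⌊(((((i : ℤ) + 1) ^ 2 * (P : ℤ) : ℤ)) : ℝ) / absRamificationIdx (ratChar u) (kOfM D (ratChar u) u (natCast_ratChar_mem u) x₀)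
        - (dSum (ratChar u) ((presAtM D (logvAnalyticVal_analyticLogvVal (K := K)) u).kk
              (fun _ : (thetaIndexOfInitial D).Caps (Setting.labelSucc i) => x₀))
            - differentOrd (ratChar u) (kOfM D (ratChar u) u (natCast_ratChar_mem u) x₀))
        - aSum (ratChar u) ((presAtM D (logvAnalyticVal_analyticLogvVal (K := K)) u).kk
            (fun _ : (thetaIndexOfInitial D).Caps (Setting.labelSucc i) => x₀))⌋
      = ⌊((((((i : ℕ) + 1) ^ 2 * P : ℕ) : ℤ) : ℝ)) / (absRamificationIdx (ratChar u) (kOfM D (ratChar u) u (natCast_ratChar_mem u) x₀) : ℝ)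
          - (((i : ℕ) : ℝ) + 1) * differentOrd (ratChar u) (kOfM D (ratChar u) u (natCast_ratChar_mem u) x₀)
          - (((i : ℕ) : ℝ) + 2) * logRadiusA (ratChar u) (absRamificationIdx (ratChar u) (kOfM D (ratChar u) u (natCast_ratChar_mem u) x₀))⌋ := by
    congr 1
    rw [hds, has]
    push_cast
    ring
  set n₁ : ℤ := ⌊(((((i : ℤ) + 1) ^ 2 * (P : ℤ) : ℤ)) : ℝ) / absRamificationIdx (ratChar u) (kOfM D (ratChar u) u (natCast_ratChar_mem u) x₀)
        - (dSum (ratChar u) ((presAtM D (logvAnalyticVal_analyticLogvVal (K := K)) u).kk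
              (fun _ : (thetaIndexOfInitial D).Caps (Setting.labelSucc i) => x₀))
            - differentOrd (ratChar u) (kOfM D (ratChar u) u (natCast_ratChar_mem u) x₀))
        - aSum (ratChar u) ((presAtM D (logvAnalyticVal_analyticLogvVal (K := K)) u).kk
            (fun _ : (thetaIndexOfInitial D).Caps (Setting.labelSucc i) => x₀))⌋ with hn₁
  set β : ℤ := ((ratChar u : ℕ) : ℤ) ^ a₀ - (absRamificationIdx (ratChar u) (kOfM D (ratChar u) u (natCast_ratChar_mem u) x₀) : ℤ) * (a₀ : ℤ) with hβ
  -- the factors as powers of `p`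
  have hnp : ‖((ratChar u : ℕ) : ℚ_[ratChar u]) ^ n₁‖ = ((ratChar u : ℕ) : ℝ) ^ ((-n₁ : ℤ) : ℝ) := by
    rw [norm_zpow, Padic.norm_p, inv_zpow', Real.rpow_intCast]
  have hϖβ : ‖(unifChoice (kOfM D (ratChar u) u (natCast_ratChar_mem u) x₀) : kOfM D (ratChar u) u (natCast_ratChar_mem u) x₀)‖ ^ β
      = ((ratChar u : ℕ) : ℝ) ^ (-((β : ℝ) / (absRamificationIdx (ratChar u) (kOfM D (ratChar u) u (natCast_ratChar_mem u) x₀) : ℝ))) :=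
    DHCrudeLog.norm_unif_zpow_eq_rpow (ratChar u) hϖ β
  have hrad : (‖(unifChoice (kOfM D (ratChar u) u (natCast_ratChar_mem u) x₀) : kOfM D (ratChar u) u (natCast_ratChar_mem u) x₀)‖ ^ β)
        ^ ((i : ℕ) + 2) = ((ratChar u : ℕ) : ℝ) ^ (-((β : ℝ) / (absRamificationIdx (ratChar u) (kOfM D (ratChar u) u (natCast_ratChar_mem u) x₀) : ℝ)) * (((i : ℕ) + 2 : ℕ) : ℝ)) := by
    rw [hϖβ, ← Real.rpow_natCast, ← Real.rpow_mul hp0.le]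
  -- the real inequality in `n₁` form
  have hineq' : (((P : ℤ) : ℝ)) / (absRamificationIdx (ratChar u) (kOfM D (ratChar u) u (natCast_ratChar_mem u) x₀) : ℝ) < (n₁ : ℝ) + (((i : ℕ) : ℝ) + 2) * ((β : ℝ) / (absRamificationIdx (ratChar u) (kOfM D (ratChar u) u (natCast_ratChar_mem u) x₀) : ℝ)) := by
    have h := hineq
    rw [← hfloor] at h
    have hb : (((((ratChar u : ℕ) : ℤ) ^ a₀ - (absRamificationIdx (ratChar u) (kOfM D (ratChar u) u (natCast_ratChar_mem u) x₀) : ℤ) * (a₀ : ℤ) : ℤ)) : ℝ) = (β : ℝ) := by rw [hβ]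
    rw [hb] at h
    linarith
  have hdeep : ‖((ratChar u : ℕ) : ℚ_[ratChar u]) ^ n₁‖ *
      (‖(unifChoice (kOfM D (ratChar u) u (natCast_ratChar_mem u) x₀) : kOfM D (ratChar u) u (natCast_ratChar_mem u) x₀)‖ ^ β)
        ^ ((i : ℕ) + 2) < ‖tqM D (ratChar u) u (natCast_ratChar_mem u) (ideleDataOf D hI) x₀‖ := by
    rw [hnp, hrad, ← Real.rpow_add hp0, hq, Real.rpow_lt_rpow_left_iff hp1]
    have hexp : ((-n₁ : ℤ) : ℝ) + -((β : ℝ) / (absRamificationIdx (ratChar u) (kOfM D (ratChar u) u (natCast_ratChar_mem u) x₀) : ℝ)) * (((i : ℕ) + 2 : ℕ) : ℝ)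
        = -((n₁ : ℝ) + (((i : ℕ) : ℝ) + 2) * ((β : ℝ) / (absRamificationIdx (ratChar u) (kOfM D (ratChar u) u (natCast_ratChar_mem u) x₀) : ℝ))) := by
      push_cast
      ring
    rw [hexp]
    linarith
  exact GenuineMShrink2.not_pilotKummerCompatHull_of_explicitDepth_star_radius D M archPk archSub Ψ act Mmod region frobAdm frobLogvol
    frobΨ frobMmod unitImage ballImage thetaDiv n lat sig split qData qK hI u i x₀ (P : ℤ) hq _ hr hdeep

end PerDatum

/-! ## §2. The RAD refutation at a rational point on the M line (classically tame local type as the one binder) -/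

/-- **EXACT-RADIUS (RAD) REFUTATION AT A RATIONAL POINT, M LINE.** `λ ∈ ℚ`, `T` a genuine Θ-volume datum at `(ratPoint λ, l)`; a finite place
`u` of `ℚ` with `p = p_u ≠ 2, l` at which `j(λ)` has a pole of order EXACTLY `h ≥ 1`; a label `j = i₀ + 1 ≤ l⋆`; natural parameters `e ≥ 1` with `p ∤ e`,
`A` with `(A−1)(p−2) < e ≤ A(p−2)`, `a₀` with `a₀ = 0 ∨ p^{a₀−1}(p−1) < e` and `e ≤ p^{a₀}(p−1)`, and an integer `N` with
**`2l·e·N ≤ (i₀+1)²·h·e − 2l·((i₀+1)·(e−1) + (i₀+2)·A)`** and **`h·e < 2l·(e·N + (i₀+2)·(p^{a₀} − e·a₀))`**. THEN at EVERY member `x₀ ∈ V̲_u` with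
`e(K_{v̲(x₀)}/ℚ_p) = e` the hull-level clause S_H FAILS at the summand-route M-level sharp setting of `T`'s OWN read-off ideles (pinned reading) for every
choice of the free context binders and Kummer datum: the member is bad with `‖t_{q,x₀}‖ = p^{−h/(2l)}` EXACTLY (abc-iut-w5-d166), its integer order
`P` has `P/e = h/(2l)`, `d = (e−1)/e`, `a = A/e`, and §1 fires by abc-iut-w5-d236's `RadRow.real_test_of_certificate`. M-line twin of p464754's
`GenuineK.not_pilotKummerCompatHull_chosen_ratPoint_of_star_envelope_of_not_dvd`. Sharp reading; refuted-as-typed only.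
[cite: Mochizuki2012, IUTchIV Cor. 2.2 (ii) proof (P5) p. 46, Prop. 1.2 (i)(ii) p. 10; IUTchIII Cor. 3.12 Step (xi-f) p. 184]
[cite: SerreLocalFields1979, Ch. III §6 Prop. 13] [cite: NeukirchANT1999, Ch. II (5.5)] [claim: Mochizuki2012, status: disputed] -/
theorem GenuineM.not_pilotKummerCompatHull_ratPoint_of_star_envelope_of_not_dvd {q : ℚ} {l : ℕ}
    (T : Cor22.ThetaVolumeDatumAt (ratPoint q) l) (u : FinitePlace ℚ) (hp2 : ratChar u ≠ 2) (hpl : ratChar u ≠ l)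
    (h : ℕ) (hh : 1 ≤ h)
    (hord : ∀ u' : HeightOneSpectrum (𝓞 ℚ), Rat.HeightOneSpectrum.natGenerator u' = ratChar u → ord ℚ u' (Cor22.jInv q) = -(h : ℤ))
    (i₀ : ℕ) (hil : i₀ + 1 ≤ (l - 1) / 2)
    (e A a₀ : ℕ) (N : ℤ) (he : 1 ≤ e) (hpe : ¬ ratChar u ∣ e)
    (hAlo : (A - 1) * (ratChar u - 2) < e) (hAhi : e ≤ A * (ratChar u - 2))
    (ha₀lo : a₀ = 0 ∨ ((ratChar u : ℕ) : ℤ) ^ (a₀ - 1) * (((ratChar u : ℕ) : ℤ) - 1) < e)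
    (ha₀hi : (e : ℤ) ≤ ((ratChar u : ℕ) : ℤ) ^ a₀ * (((ratChar u : ℕ) : ℤ) - 1))
    (hN1 : 2 * (l : ℤ) * e * N ≤ ((i₀ : ℤ) + 1) ^ 2 * h * e - 2 * l * (((i₀ : ℤ) + 1) * ((e : ℤ) - 1) + ((i₀ : ℤ) + 2) * A))
    (hN2 : (h : ℤ) * e < 2 * l * ((e : ℤ) * N + ((i₀ : ℤ) + 2) * (((ratChar u : ℕ) : ℤ) ^ a₀ - e * a₀))) :
    letI := T.instFieldF; letI := T.instNumberFieldF; letI := T.instAlgebraF; letI := T.instFieldK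
    letI := T.instNumberFieldK; letI := T.instAlgebraK; letI := T.instFieldFbar; letI := T.instAlgebraFbar
    letI := T.instAlgebraKFbar; letI := T.instIsElliptic
    ∀ (x₀ : (thetaIndexOfInitial T.D).Fibre (Val.non u)),
      absRamificationIdx (ratChar u) (kOfM T.D (ratChar u) u (natCast_ratChar_mem u) x₀) = e →
    ∀ (M : Type) [Field M] [NumberField M]
      (archPk : ∀ (j : (thetaIndexOfInitial T.D).Label) (vQ : (thetaIndexOfInitial T.D).VQ),
        Set ((logShellsOfInitialDH T.D (analyticLogvVal T.K)).Packet j vQ))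
      (archSub : ∀ (j : (thetaIndexOfInitial T.D).Label) (v : (thetaIndexOfInitial T.D).V),
        Set ((logShellsOfInitialDH T.D (analyticLogvVal T.K)).Packet j ((thetaIndexOfInitial T.D).over v)))
      (Ψ : ℤ → ∀ v : (thetaIndexOfInitial T.D).V, v ∈ (thetaIndexOfInitial T.D).Vbad →
        Set ((logShellsOfInitialDH T.D (analyticLogvVal T.K)).StarPacket v))
      (act : ℤ → ∀ v : (thetaIndexOfInitial T.D).V, v ∈ (thetaIndexOfInitial T.D).Vbad →
        (logShellsOfInitialDH T.D (analyticLogvVal T.K)).StarPacket v →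
          Module.End ℚ ((logShellsOfInitialDH T.D (analyticLogvVal T.K)).StarPacket v))
      (Mmod : ℤ → ∀ j : (thetaIndexOfInitial T.D).LabelStar, Set ((logShellsOfInitialDH T.D (analyticLogvVal T.K)).GlobalPacket j.1))
      (region : ℤ → ∀ j : (thetaIndexOfInitial T.D).LabelStar, FinDivisor M → ∀ vQ : (thetaIndexOfInitial T.D).VQ,
        Set ((logShellsOfInitialDH T.D (analyticLogvVal T.K)).Packet j.1 vQ))
      (frobAdm : ℤ → ℤ → ∀ (j : (thetaIndexOfInitial T.D).Label) (vQ : (thetaIndexOfInitial T.D).VQ),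
        Set ((logShellsOfInitialDH T.D (analyticLogvVal T.K)).Packet j vQ) → Prop)
      (frobLogvol : ℤ → ℤ → ∀ (j : (thetaIndexOfInitial T.D).Label) (vQ : (thetaIndexOfInitial T.D).VQ),
        Set ((logShellsOfInitialDH T.D (analyticLogvVal T.K)).Packet j vQ) → ℝ)
      (frobΨ : ℤ → ℤ → ∀ v : (thetaIndexOfInitial T.D).V, v ∈ (thetaIndexOfInitial T.D).Vbad →
        Set ((logShellsOfInitialDH T.D (analyticLogvVal T.K)).StarPacket v))
      (frobMmod : ℤ → ℤ → ∀ j : (thetaIndexOfInitial T.D).LabelStar, Set ((logShellsOfInitialDH T.D (analyticLogvVal T.K)).GlobalPacket j.1))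
      (unitImage : ℤ → ℤ → ℕ → ∀ (j : (thetaIndexOfInitial T.D).Label) (vQ : (thetaIndexOfInitial T.D).VQ),
        Set ((logShellsOfInitialDH T.D (analyticLogvVal T.K)).Packet j vQ))
      (ballImage : ℤ → ℤ → ∀ (j : (thetaIndexOfInitial T.D).Label) (vQ : (thetaIndexOfInitial T.D).VQ),
        Set ((logShellsOfInitialDH T.D (analyticLogvVal T.K)).Packet j vQ))
      (thetaDiv : ℤ → ℤ → LgpDivisor M (thetaIndexOfInitial T.D).lstar)
      (n : ℤ) {HT : Type} {LogLink : HT → HT → Type} {IsFull : ∀ {s t : HT}, LogLink s t → Prop}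
      (lat : LGPGaussianLogThetaLattice LogLink IsFull)
      {Frd : Type} {IsoF : Frd → Frd → Type} {Ob : Frd → Type} {realify : Frd → Frd} {Strip : Type}
      {IsoS : Strip → Strip → Type} {Mv : ∀ v : (thetaIndexOfInitial T.D).V, v ∈ (thetaIndexOfInitial T.D).Vbad → Type}
      [∀ v h, Monoid (Mv v h)]
      (sig : GlobalLGPFrobenioidSignature (thetaIndexOfInitial T.D).lstar (thetaIndexOfInitial T.D).V
        (· ∈ (thetaIndexOfInitial T.D).Vbad) Frd IsoF Ob realify Strip IsoS Mv)
      (split : SplittingMonoids Mv) {ObΔ : Type} {N : ∀ v : (thetaIndexOfInitial T.D).V, v ∈ (thetaIndexOfInitial T.D).Vbad → Type}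
      [∀ v h, Monoid (N v h)] (qData : QPilotData ObΔ N)
      (qK : ∀ v : (thetaIndexOfInitial T.D).V, v ∈ (thetaIndexOfInitial T.D).Vbad →
        Set ((logShellsOfInitialDH T.D (analyticLogvVal T.K)).StarPacket v)),
      ¬ Cor312Vol.PilotKummerCompatHull
        (LatticeSituation.ofShells (logShellsOfInitialDH T.D (analyticLogvVal T.K)) M archPk archSub
          (summandPiecesPrM T.D (logvAnalyticVal_analyticLogvVal (K := T.K))).Adm (summandPiecesPrM T.D (logvAnalyticVal_analyticLogvVal (K := T.K))).logvol Ψ act Mmod region frobAdm frobLogvol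
          frobΨ frobMmod unitImage ballImage thetaDiv)
        (settingPrVolSharpM T.D (logvAnalyticVal_analyticLogvVal (K := T.K)) (tOfIdeleData T.D (ideleDataOf T.D T.isVolumeInputOf))
          (fun u x => tqM T.D (ratChar u) u (natCast_ratChar_mem u) (ideleDataOf T.D T.isVolumeInputOf) x) M archPk archSub Ψ act Mmod region n lat sig split qData
          (fun u x => tqM_ne_zero T.D (ratChar u) u (natCast_ratChar_mem u) (ideleDataOf T.D T.isVolumeInputOf) x)
          (GenuineM.finite_ratPlaces_under_S T.D).toFinset
          (fun u x hu => norm_tqM_eq_one_of_not_mem T.D (ratChar u) u (natCast_ratChar_mem u) (ideleDataOf T.D T.isVolumeInputOf) x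
            fun hx => hu ((Set.Finite.mem_toFinset _).mpr ⟨x, hx⟩)))
        (fun _ => Cor312.Setting.qRegion
          (settingPrVolSharpM T.D (logvAnalyticVal_analyticLogvVal (K := T.K)) (tOfIdeleData T.D (ideleDataOf T.D T.isVolumeInputOf))
          (fun u x => tqM T.D (ratChar u) u (natCast_ratChar_mem u) (ideleDataOf T.D T.isVolumeInputOf) x) M archPk archSub Ψ act Mmod region n lat sig split qData
          (fun u x => tqM_ne_zero T.D (ratChar u) u (natCast_ratChar_mem u) (ideleDataOf T.D T.isVolumeInputOf) x)
          (GenuineM.finite_ratPlaces_under_S T.D).toFinset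
          (fun u x hu => norm_tqM_eq_one_of_not_mem T.D (ratChar u) u (natCast_ratChar_mem u) (ideleDataOf T.D T.isVolumeInputOf) x
            fun hx => hu ((Set.Finite.mem_toFinset _).mpr ⟨x, hx⟩)))) qK := by
  classical
  letI := T.instFieldF; letI := T.instNumberFieldF; letI := T.instAlgebraF; letI := T.instFieldK
  letI := T.instNumberFieldK; letI := T.instAlgebraK; letI := T.instFieldFbar; letI := T.instAlgebraFbar
  letI := T.instAlgebraKFbar; letI := T.instIsElliptic
  intro x₀ hex M _ _ archPk archSub Ψ act Mmod region frobAdm frobLogvol frobΨ frobMmod unitImage ballImage thetaDiv n HT LogLink IsFull lat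
    Frd IsoF Ob realify Strip IsoS Mv _ sig split ObΔ N' _ qData qK
  haveI hpfact : Fact (ratChar u).Prime := inferInstance
  -- the label `j = i₀ + 1 ≤ l⋆` as an index
  have hlstar : (thetaIndexOfInitial T.D).lstar = (l - 1) / 2 := rfl
  have hlt : i₀ < (thetaIndexOfInitial T.D).lstar := by rw [hlstar]; omega
  have hl1 : 1 ≤ l := by have := T.D.five_le_l; omega
  have hp2' : 2 < ratChar u := by
    have := hpfact.out.two_le
    omega
  have hp1 : (1 : ℝ) < ((ratChar u : ℕ) : ℝ) := by exact_mod_cast hpfact.out.one_lt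
  have he0 : (0 : ℝ) < (e : ℝ) := by exact_mod_cast he
  -- the member is bad (abc-iut-w5-d166), and the read-off q-idele has norm `p^{−h/(2l)}` EXACTLY (rational `j`, ramification cancels)
  obtain ⟨hS, -⟩ := placeModOfM_mem_S_and_norm_tqM_le_of_ratPoint T.D (ratChar u) u (natCast_ratChar_mem u)
    (ideleDataOf T.D T.isVolumeInputOf) q T.j_eq T.isP5Choice x₀ hp2 hpl h hh (fun u' hu' => (hord u' hu').le)
  have hjF : T.E.j = (((Cor22.jInv q : ℚ)) : T.F) := by rw [T.j_eq]; exact eq_ratCast _ _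
  have hn1 := norm_tqM_eq_rpow_ord_rat T.D (ratChar u) u (natCast_ratChar_mem u) (ideleDataOf T.D T.isVolumeInputOf) x₀ hS
    (Cor22.jInv q) hjF
  rw [hord _ (natGenerator_finBelow_placeModOfM T.D (ratChar u) u (natCast_ratChar_mem u) x₀)] at hn1
  -- the integer order of the q-idele at the norm-uniformizer: `‖t_{q,x₀}‖ = p^{−m/e}`
  obtain ⟨mq, hmq⟩ := exists_int_norm_tqM_eq_zpow T.D (ratChar u) u (natCast_ratChar_mem u) (ideleDataOf T.D T.isVolumeInputOf) x₀
    (isUniformizer_unifChoice (kOfM T.D (ratChar u) u (natCast_ratChar_mem u) x₀))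
  have hq : ‖tqM T.D (ratChar u) u (natCast_ratChar_mem u) (ideleDataOf T.D T.isVolumeInputOf) x₀‖ =
      ((ratChar u : ℕ) : ℝ) ^ (-((mq : ℝ) / (absRamificationIdx (ratChar u) (kOfM T.D (ratChar u) u (natCast_ratChar_mem u) x₀) : ℝ))) := by
    rw [hmq]
    exact DHCrudeLog.norm_unif_zpow_eq_rpow (ratChar u) (isUniformizer_unifChoice _) mq
  -- `m/e = h/(2l)`, hence `m = P ∈ ℕ`
  have hPe0 : (mq : ℝ) / (e : ℝ) = (h : ℝ) / (2 * l) := by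
    have hE : ((ratChar u : ℕ) : ℝ) ^ (-((mq : ℝ) / (e : ℝ))) = ((ratChar u : ℕ) : ℝ) ^ ((((-(h : ℤ) : ℤ)) : ℝ) / (2 * l)) := by
      rw [← hn1, hq, hex]
    have h1 : -((mq : ℝ) / (e : ℝ)) ≤ (((-(h : ℤ) : ℤ)) : ℝ) / (2 * l) := (Real.rpow_le_rpow_left_iff hp1).mp hE.le
    have h2 : (((-(h : ℤ) : ℤ)) : ℝ) / (2 * l) ≤ -((mq : ℝ) / (e : ℝ)) := (Real.rpow_le_rpow_left_iff hp1).mp hE.ge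
    have h3 : -((mq : ℝ) / (e : ℝ)) = (((-(h : ℤ) : ℤ)) : ℝ) / (2 * l) := le_antisymm h1 h2
    push_cast at h3
    rw [neg_div, neg_inj] at h3
    exact h3
  have hmqpos : (0 : ℝ) < (mq : ℝ) := by
    have hl0 : (0 : ℝ) < (l : ℝ) := by exact_mod_cast hl1
    have hh0 : (0 : ℝ) < (h : ℝ) := by exact_mod_cast hh
    have h1 : (0 : ℝ) < (mq : ℝ) / (e : ℝ) := by rw [hPe0]; positivity
    exact (div_pos_iff_of_pos_right he0).mp h1
  obtain ⟨P, rfl⟩ : ∃ P : ℕ, (P : ℤ) = mq := ⟨mq.toNat, Int.toNat_of_nonneg (by exact_mod_cast hmqpos.le)⟩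
  have hPe : (((P : ℤ) : ℝ)) / (e : ℝ) = (h : ℝ) / (2 * l) := by exact_mod_cast hPe0
  -- the closed forms of the [IUTchIV] Prop. 1.2 constants and the turning point at `e`
  have ha : logRadiusA (ratChar u) e = (A : ℝ) / e := logRadiusA_eq_of_window hp2' he hAlo hAhi
  have hδ : (e : ℝ) * differentOrd (ratChar u) (kOfM T.D (ratChar u) u (natCast_ratChar_mem u) x₀) ≤ ((e - 1 : ℕ) : ℝ) := by
    have hnd : ¬ ratChar u ∣ absRamificationIdx (ratChar u) (kOfM T.D (ratChar u) u (natCast_ratChar_mem u) x₀) := by rwa [hex]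
    rw [differentOrd_eq_of_not_dvd (ratChar u) (kOfM T.D (ratChar u) u (natCast_ratChar_mem u) x₀) hnd, hex, Nat.cast_sub he,
      Nat.cast_one]
    have he0' : (e : ℝ) ≠ 0 := he0.ne'
    rw [mul_div_cancel₀ _ he0']
  have hlo : ∀ a < a₀, ((ratChar u : ℕ) : ℤ) ^ a * (((ratChar u : ℕ) : ℤ) - 1) < absRamificationIdx (ratChar u) (kOfM T.D (ratChar u) u (natCast_ratChar_mem u) x₀) := by
    rw [hex]
    exact RadRow.turning_of_bounds ha₀lo
  have hhi : (absRamificationIdx (ratChar u) (kOfM T.D (ratChar u) u (natCast_ratChar_mem u) x₀) : ℤ) ≤ ((ratChar u : ℕ) : ℤ) ^ a₀ * (((ratChar u : ℕ) : ℤ) - 1) := by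
    rw [hex]
    exact ha₀hi
  have hN1' : 2 * (l : ℤ) * e * N ≤ ((i₀ : ℤ) + 1) ^ 2 * h * e - 2 * l * (((i₀ : ℤ) + 1) * ((e - 1 : ℕ) : ℤ) + ((i₀ : ℤ) + 2) * A) := by
    rw [Nat.cast_sub he, Nat.cast_one]
    exact hN1
  -- the real RAD test (abc-iut-w5-d236's arithmetic)
  have htest := RadRow.real_test_of_certificate (p := ratChar u) (i₀ := i₀) (a₀ := a₀)
    (d := differentOrd (ratChar u) (kOfM T.D (ratChar u) u (natCast_ratChar_mem u) x₀)) (a := logRadiusA (ratChar u) e)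
    he hl1 hPe hδ ha hN1' hN2
  have hqP : ‖tqM T.D (ratChar u) u (natCast_ratChar_mem u) (ideleDataOf T.D T.isVolumeInputOf) x₀‖ =
      ((ratChar u : ℕ) : ℝ) ^ (-((((P : ℤ) : ℝ)) / (absRamificationIdx (ratChar u) (kOfM T.D (ratChar u) u (natCast_ratChar_mem u) x₀) : ℝ))) := by
    rw [hq]
  refine GenuineMShrink2.not_pilotKummerCompatHull_of_star_envelope_ineq T.D M archPk archSub Ψ act Mmod region frobAdm frobLogvol frobΨ
    frobMmod unitImage ballImage thetaDiv n lat sig split qData qK T.isVolumeInputOf u ⟨i₀, hlt⟩ x₀ P hqP a₀ hlo hhi ?_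
  rw [hex]
  exact htest

end Summit.ABC.IUTFork.Conditional

end
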